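import Summits.HubbardSuperconductivity.HubbardLadder.Bounds.ThermalMottStiffnessCeiling
import Literature.MathematicalPhysics.QuantumLattice.HubbardKuboKishiFSum
import Literature.MathematicalPhysics.QuantumLattice.HubbardGrandCanonicalDensity
import HarnessLib

/-!
# Hubbard ladder — Bounds: generic grand-canonical glue for `ThermalMottCDWCeiling`

HONEST FRAMING (cell pub-hubbard): ladder R1–R4 with certified numbers; no claim on H/H₀.
Helper module of `Bounds/ThermalMottCDWCeiling.lean` (bounds.tex Cor. 11.1(i)–(ii)), split off only
to respect the 400-line limit of the gate (LEAN FILING REQUEST #163, filed by the lit seat for bounds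
g19/g20; the statements are byte-identical to the staged one-file version, sha256 db02ea56…). Contents
(every finite graph, all `t U μ`, full Fock space): `groundEnergy_le_re_gibbsState` (`E₀(A) ≤ Re⟨A⟩_{β,H}`),
`hoppingForm_congr_adj`, `hoppingForm_const`, `groundEnergy_hamiltonianWith_le`
(`E₀(H(t,U) − μN) ≤ E_G(t,U;N) − μN`), `le_groundEnergy_hamiltonianWith` (an all-`N` floor of the
canonical energies bounds the grand-canonical ground energy). The torus statements and the three nodes
`ThermalMottKineticCeilingGC`, `ThermalMottCDWCeilingKK`, `ThermalMottCDWCeilingU20KK` are in the main file.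
References (keys of `lean/references.bib`): KuboKishi1990 Thm 2, Remark 3; LangerMattis1971
eqs. (3)–(5); DysonLiebSimon1978 Thm 3.1; HazraVermaRanderia2019 §III.
-/

noncomputable section

namespace Summit.HubbardSuperconductivity.HubbardLadder.Bounds

open Matrix Finset Real
open Literature.MathematicalPhysics.QuantumLattice
open Literature.MathematicalPhysics.QuantumFieldTheory
open Literature.Probability.LatticeModels
open scoped ComplexOrder ComplexConjugate

/-! ### Generic grand-canonical glue -/

section GenericGibbs

variable {n : Type*} [Fintype n] [DecidableEq n]

/-- **Gibbs states do not go below the ground energy**: `E₀(A) ≤ Re⟨A⟩_{β,H}` for Hermitian `A`, `H`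
(`A - E₀(A)·1 ≥ 0` and Gibbs positivity). -/
theorem groundEnergy_le_re_gibbsState [Nonempty n] {H A : Matrix n n ℂ} (hH : H.IsHermitian)
    (hA : A.IsHermitian) (β : ℝ) : A.groundEnergy ≤ (gibbsState β H A).re := by
  have hpsd : (A - ((A.groundEnergy : ℝ) : ℂ) • (1 : Matrix n n ℂ)).PosSemidef := by
    have h := posSemidef_sub_groundEnergy hA
    rw [Algebra.algebraMap_eq_smul_one, RCLike.real_smul_eq_coe_smul (K := ℂ)] at h
    exact h
  have h0 := gibbsState_nonneg_of_posSemidef β hH hpsd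
  rw [map_sub, map_smul, gibbsState_one β H (partitionFn_pos β hH).ne', smul_eq_mul, mul_one] at h0
  obtain ⟨hre, -⟩ := Complex.nonneg_iff.mp h0
  rw [Complex.sub_re, Complex.ofReal_re] at hre
  linarith

end GenericGibbs

section GenericHubbard

variable {Λ : Type*} [LinearOrder Λ] [Fintype Λ] (G : SimpleGraph Λ) [DecidableRel G.Adj]

/-- `T(w)` only sees the bond values of `w`. -/
theorem hoppingForm_congr_adj {w w' : Λ → Λ → ℝ} (hw : ∀ x y, G.Adj x y → w x y = w' x y) :
    hoppingForm G w = hoppingForm G w' := by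
  rw [hoppingForm_eq, hoppingForm_eq]
  refine Finset.sum_congr rfl fun x _ => Finset.sum_congr rfl fun y _ =>
    Finset.sum_congr rfl fun σ _ => ?_
  by_cases hxy : G.Adj x y
  · rw [if_pos hxy, if_pos hxy, hw x y hxy]
  · rw [if_neg hxy, if_neg hxy]

/-- `T(c) = c · T(1)` for a constant bond weight. -/
theorem hoppingForm_const (c : ℝ) :
    hoppingForm G (fun _ _ => c) = (c : ℂ) • hoppingForm G fun _ _ => 1 := by
  rw [hoppingForm_eq, hoppingForm_eq, Finset.smul_sum]
  refine Finset.sum_congr rfl fun x _ => ?_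
  rw [Finset.smul_sum]
  refine Finset.sum_congr rfl fun y _ => ?_
  rw [Finset.smul_sum]
  refine Finset.sum_congr rfl fun σ _ => ?_
  by_cases hxy : G.Adj x y
  · rw [if_pos hxy, if_pos hxy, smul_smul, Complex.ofReal_one, mul_one]
  · rw [if_neg hxy, if_neg hxy, smul_zero]

/- The full-Fock-space statements below carry the CALLER's `DecidableEq` instance on the
configuration type (a local instance argument, synthesised at each use site), so that they apply
verbatim on concrete lattices such as the torus, whose structural instance differs syntactically
from the one derived from the linear order. -/
variable [DecidableEq (Finset (Orb Λ))]

/-- **Grand-canonical ground energy ≤ sector value**: `E₀(H(t,U) - μN) ≤ E_G(t,U;N) - μN` for every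
`N ≤ 2|Λ|` (the unit `N`-particle ground state is a trial state). -/
theorem groundEnergy_hamiltonianWith_le (t U μ : ℝ) {N : ℕ} (hN : N ≤ 2 * Fintype.card Λ) :
    (hamiltonianWith G t U μ).groundEnergy ≤ groundEnergyAt G t U N - μ * N := by
  obtain ⟨ψ, hψN, hψ1, hHψ⟩ := ThermodynamicLimit.exists_unit_groundState G t U hN
  have h := groundEnergy_le_rayleigh_holds (isHermitian_hamiltonianWith G t U μ) ψ hψ1
  have hmv : hamiltonianWith G t U μ *ᵥ ψ =
      (((groundEnergyAt G t U N : ℝ) : ℂ) - (μ : ℂ) * (N : ℂ)) • ψ := by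
    rw [hamiltonianWith_eq, sub_mulVec, smul_mulVec, hHψ, totalNumber_mulVec_of_isNParticle hψN,
      smul_smul, ← sub_smul]
  rw [hmv, dotProduct_smul, hψ1, smul_eq_mul, mul_one] at h
  have e : (((groundEnergyAt G t U N : ℝ) : ℂ) - (μ : ℂ) * (N : ℂ)).re =
      groundEnergyAt G t U N - μ * N := by
    simp
  linarith

/-- **Sector floors bound the grand-canonical ground energy from below**: if
`c ≤ E_G(t,U;N) - μN` for every `N ≤ 2|Λ|`, then `c ≤ E₀(H(t,U) - μN)` — a ground vector of
`H - μN` has a non-zero `(N↑,N↓)`-sector component, which is again a ground vector since `H - μN`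
preserves the sectors, and on it the sector variational principle applies. -/
theorem le_groundEnergy_hamiltonianWith (t U μ c : ℝ)
    (h : ∀ N : ℕ, N ≤ 2 * Fintype.card Λ → c ≤ groundEnergyAt G t U N - μ * N) :
    c ≤ (hamiltonianWith G t U μ).groundEnergy := by
  have hH : (hamiltonianWith G t U μ).IsHermitian := isHermitian_hamiltonianWith G t U μ
  obtain ⟨ψ, hψmem, hψ0⟩ := (Submodule.ne_bot_iff _).1 (groundSpace_ne_bot_holds hH)
  rw [mem_groundSpace_iff] at hψmem
  obtain ⟨s, hs⟩ := Function.ne_iff.1 hψ0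
  -- the `(N↑, N↓)`-sector of a configuration carrying `ψ`
  obtain ⟨a, ha⟩ : ∃ a : ℕ, (upPart s).card = a := ⟨_, rfl⟩
  obtain ⟨b, hb⟩ : ∃ b : ℕ, (downPart s).card = b := ⟨_, rfl⟩
  have hφs : sectorProj a b ψ s = ψ s := by
    rw [sectorProj_apply, if_pos ⟨ha, hb⟩]
  have hφ0 : sectorProj a b ψ ≠ 0 := by
    intro h0
    apply hs
    rw [← hφs, h0, Pi.zero_apply]
  -- `H - μN` preserves the sectors
  have hpres : PreservesSectors (hamiltonianWith G t U μ) := by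
    have e : hamiltonianWith G t U μ = hamiltonian G t U + (-(μ : ℂ)) • totalNumber := by
      rw [hamiltonianWith_eq, sub_eq_add_neg, neg_smul]
    rw [e]
    refine (LiebThm1.preservesSectors_hamiltonian G t U).add (PreservesSectors.smul ?_ _)
    rw [LiebThm1.totalNumber_eq_diagonal]
    exact PreservesSectors.diagonal _
  have hHφ : hamiltonianWith G t U μ *ᵥ sectorProj a b ψ =
      (((hamiltonianWith G t U μ).groundEnergy : ℝ) : ℂ) • sectorProj a b ψ := by
    rw [hpres.mulVec_sectorProj, hψmem, sectorProj_smul]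
  have hsec : IsInSector a b (sectorProj a b ψ) := isInSector_sectorProj a b ψ
  have hNφ : IsNParticle (a + b) (sectorProj a b ψ) := hsec.isNParticle
  have hab : a + b ≤ 2 * Fintype.card Λ := by
    have h1 : a ≤ Fintype.card Λ := ha ▸ Finset.card_le_univ (upPart s)
    have h2 : b ≤ Fintype.card Λ := hb ▸ Finset.card_le_univ (downPart s)
    omega
  -- the norm of the component is positive
  have hnn : 0 ≤ star (sectorProj a b ψ) ⬝ᵥ sectorProj a b ψ := dotProduct_star_self_nonneg _
  have hpos : 0 < (star (sectorProj a b ψ) ⬝ᵥ sectorProj a b ψ).re := by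
    obtain ⟨hre, him⟩ := Complex.nonneg_iff.1 hnn
    rcases hre.lt_or_eq with hlt | heq
    · exact hlt
    · exfalso
      apply hφ0
      rw [← LiebThm1.star_dotProduct_self_eq_zero_iff]
      exact Complex.ext (by simpa using heq.symm) (by simpa using him.symm)
  -- energy bookkeeping on the component
  have hE : (star (sectorProj a b ψ) ⬝ᵥ (hamiltonianWith G t U μ *ᵥ sectorProj a b ψ)).re =
      (hamiltonianWith G t U μ).groundEnergy * (star (sectorProj a b ψ) ⬝ᵥ sectorProj a b ψ).re := by
    rw [hHφ, dotProduct_smul, smul_eq_mul, Complex.re_ofReal_mul]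
  have hsplit : (star (sectorProj a b ψ) ⬝ᵥ (hamiltonianWith G t U μ *ᵥ sectorProj a b ψ)).re =
      (star (sectorProj a b ψ) ⬝ᵥ (hamiltonian G t U *ᵥ sectorProj a b ψ)).re -
        μ * ((a : ℝ) + b) * (star (sectorProj a b ψ) ⬝ᵥ sectorProj a b ψ).re := by
    rw [hamiltonianWith_eq, sub_mulVec, smul_mulVec, totalNumber_mulVec_of_isNParticle hNφ,
      smul_smul, dotProduct_sub, dotProduct_smul, Complex.sub_re, smul_eq_mul]
    have e : ((μ : ℂ) * ((a + b : ℕ) : ℂ)) = ((μ * ((a : ℝ) + b) : ℝ) : ℂ) := by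
      push_cast
      ring
    rw [e, Complex.re_ofReal_mul]
  have hvar := LiebThm1.groundEnergy_mul_norm_le (hamiltonian G t U) hNφ
  unfold Literature.MathematicalPhysics.QuantumLattice.expect at hvar
  have hc := h (a + b) hab
  unfold groundEnergyAt at hc
  push_cast at hc
  have hcn := mul_le_mul_of_nonneg_right hc hpos.le
  have hkey : c * (star (sectorProj a b ψ) ⬝ᵥ sectorProj a b ψ).re ≤
      (hamiltonianWith G t U μ).groundEnergy * (star (sectorProj a b ψ) ⬝ᵥ sectorProj a b ψ).re := by
    rw [← hE, hsplit]
    nlinarith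
  exact le_of_mul_le_mul_right hkey hpos

end GenericHubbard

end Summit.HubbardSuperconductivity.HubbardLadder.Bounds

end
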